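import Summits.QuantumFields.YangMills.Theorems.PencilRigidityDiagonalMirrorRPRStubRpClosureLattice
import Literature.MathematicalPhysics.QuantumLattice.SchwingerOSPositivity

/-!
# Crux `DiagonalMirrorRPR` (stmt-QuantumFields-10604), stub `stub_rpClosure`: support bookkeeping on the cover
# and test-function bookkeeping in a frame

Part of the proof of the registered stub `stub_rpClosure` (S4) of the skeleton
`Cruxes/DiagonalMirrorRPR/Lines/parity_bridge_cold_traces.lean` (crux `DiagonalMirrorRPR`, stmt-QuantumFields-10604,
routes `PencilRigidity` = `MirrorModularBoosts`), split by topic over the modules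
`…StubRpClosureDefs` (vocabulary, frames) ← `…StubRpClosureLattice` (swap on the cover, expectations, lattice Gram
positivity), `…StubRpClosureSupport` (support bookkeeping, test functions) and `…StubRpClosureDensity` (ordered-wedge
density with compact supports) ← `…StubRpClosure` (the limit argument and the stub).

This module (namespace `RpClosure`): §C the closed positive half `0 ≤ u ≤ N` of the cover — an edge of `ℤ⁴` whose
sheared coordinate `u = z₀ − z₁` lies in `[1, N−1]` projects into it, so a smeared field whose test function only
charges lattice points keeping a margin from both mirror layers is a cylinder function of `posEdges N`
(`stub_rpClosure_support`), with measurability and bounds; §E test functions — `⁰𝒮` is stable under frames,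
appended slab families (the real factors of `Θ P_I* ⊗ P_J`) are supported in pairwise ordered time slabs hence
off-diagonal, compact supports, the reflected factor in the frame is the swapped factor, and where a frame-rotated
slab factor charges the lattice; §G the scheme eventually has `L_k ≥ 1`, `a_k` small, `a_k L_k` large.

References: Osterwalder–Schrader, Comm. Math. Phys. 31 (1973) §2; Glimm–Jaffe, *Quantum Physics* §6.1.
-/

set_option autoImplicit false

noncomputable section

open scoped SchwartzMap ComplexConjugate InnerProductSpace
open MeasureTheory Filter Topology
open Literature.MathematicalPhysics.QuantumLattice Literature.MathematicalPhysics.AQFT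
  Literature.MathematicalPhysics.QuantumFieldTheory

namespace Summit.QuantumFields.YangMills.Cruxes.DiagonalMirrorRPR.ParityBridgeColdTraces

namespace RpClosure

/-! ## §C Support bookkeeping on the cover: the positive half, cylinder dependence, bounds -/

section CoverSupport

open Literature.Probability.LatticeModels (Site box mem_box)

variable {N : ℕ} [NeZero N]

omit [NeZero N] in
/-- The first sheared coordinate of the steps: `e₀ ↦ 1`, `e₁ ↦ −1`, `e₂, e₃ ↦ 0`. -/
theorem exists_tstep_fst (i : Fin 4) :
    ∃ δ : ℤ, -1 ≤ δ ∧ δ ≤ 1 ∧ (tstep (n₀ := 2 * N) (n₁ := N) (N := N) true i).1 = (δ : ZMod (2 * N)) := by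
  fin_cases i
  · exact ⟨1, by norm_num, by norm_num, by simp [tstep]⟩
  · exact ⟨-1, by norm_num, by norm_num, by simp [tstep]⟩
  · exact ⟨0, by norm_num, by norm_num, by simp [tstep]⟩
  · exact ⟨0, by norm_num, by norm_num, by simp [tstep]⟩

/-- The value of a small non-negative integer in `ZMod (2N)`. -/
theorem val_intCast_le {u : ℤ} (h0 : 0 ≤ u) (hu : u ≤ N) : ((u : ZMod (2 * N)).val) ≤ N := by
  have hN : 0 < N := Nat.pos_of_ne_zero (NeZero.ne N)
  have hv : (((u : ZMod (2 * N)).val : ℕ) : ℤ) = u := by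
    rw [ZMod.val_intCast]
    exact Int.emod_eq_of_lt h0 (by push_cast; omega)
  omega

/-- An edge of `ℤ⁴` whose sheared coordinate `u = z₀ − z₁` lies in `[1, N − 1]` projects into the closed
positive half of the cover. -/
theorem skewProj_mem_posEdges (z : Site 4) (i : Fin 4) (h1 : 1 ≤ z 0 - z 1) (h2 : z 0 - z 1 + 1 ≤ N) :
    (skewProj N z, i) ∈ posEdges N := by
  obtain ⟨δ, hδ1, hδ2, hδ⟩ := exists_tstep_fst (N := N) i
  refine ⟨val_intCast_le (by omega) (by omega), ?_⟩
  show ((((z 0 - z 1 : ℤ)) : ZMod (2 * N)) + (tstep (n₀ := 2 * N) (n₁ := N) (N := N) true i).1).val ≤ N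
  rw [hδ, ← Int.cast_add]
  exact val_intCast_le (by omega) (by omega)

variable {G : Type} [Group G] [MeasurableSpace G]

/-- A finite edge set has a radius. -/
theorem exists_radius (S : Finset (Literature.MathematicalPhysics.QuantumLattice.ZdEdge 4)) :
    ∃ ϱ : ℕ, ∀ e ∈ S, ∀ i, |e.1 i| ≤ (ϱ : ℤ) := by
  -- adapted from `hasLatticeMassGap_of_beta_eq_zero` (Cruxes/DiagonalMirrorRPR/Disproof §2, `hRad`)
  refine ⟨S.sum fun e => ∑ i, (e.1 i).natAbs, fun e he i => ?_⟩
  have h1 : (e.1 i).natAbs ≤ ∑ j, (e.1 j).natAbs :=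
    Finset.single_le_sum (f := fun j => (e.1 j).natAbs) (fun _ _ => Nat.zero_le _) (Finset.mem_univ i)
  have h2 : ∑ j, (e.1 j).natAbs ≤ S.sum fun e => ∑ j, (e.1 j).natAbs :=
    Finset.single_le_sum (f := fun e => ∑ j, (e.1 j).natAbs) (fun _ _ => Nat.zero_le _) he
  rw [Int.abs_eq_natAbs]
  exact_mod_cast h1.trans h2

/-- **Cylinder dependence on the positive half.** If the test function only charges lattice points whose
sheared coordinate `u = x₀ − x₁` keeps the margin `2ϱ + 1` from both mirror layers (`ϱ` a radius of the
observable's edge support), the smeared field on the cover depends only on the edges of the closed positive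
half `0 ≤ u ≤ N`. -/
theorem dependsOn_smearedLatticeField (O : YMSpecies G) {ϱ : ℕ} (hϱ : ∀ e ∈ O.supp, ∀ i, |e.1 i| ≤ (ϱ : ℤ))
    (Λ : Finset (Site 4)) (a cc m : ℝ) (h : 𝓢(E4, ℝ))
    (hsupp : ∀ x ∈ Λ, h (a • siteToE x) ≠ 0 → (2 * ϱ + 1 : ℤ) ≤ x 0 - x 1 ∧ x 0 - x 1 + 2 * ϱ + 2 ≤ N) :
    DependsOn (fun U : TConfig (2 * N) N N G => smearedLatticeField O.F Λ a cc m h (skewLift N U))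
      (posEdges N) := by
  intro U V hUV
  dsimp only
  unfold smearedLatticeField
  congr 1
  refine Finset.sum_congr rfl fun x hx => ?_
  by_cases h0 : h (a • siteToE x) = 0
  · rw [h0, zero_mul, zero_mul]
  congr 2
  refine O.isCylinder fun e he => ?_
  simp only [configShift_apply, skewLift]
  refine hUV _ ?_
  obtain ⟨hlo, hhi⟩ := hsupp x hx h0
  have he0 := hϱ e (Finset.mem_coe.1 he) 0
  have he1 := hϱ e (Finset.mem_coe.1 he) 1
  rw [abs_le] at he0 he1
  have h01 : (e.1 - -x) 0 - (e.1 - -x) 1 = (x 0 - x 1) + (e.1 0 - e.1 1) := by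
    simp only [Pi.sub_apply, Pi.neg_apply]; ring
  refine skewProj_mem_posEdges _ _ ?_ ?_
  · rw [h01]; omega
  · rw [h01]; omega

omit [NeZero N] in
/-- The smeared field on the cover is measurable. -/
theorem measurable_smearedLatticeField_skewLift (O : YMSpecies G) (Λ : Finset (Site 4)) (a cc m : ℝ)
    (h : 𝓢(E4, ℝ)) :
    Measurable fun U : TConfig (2 * N) N N G => smearedLatticeField O.F Λ a cc m h (skewLift N U) := by
  unfold smearedLatticeField
  refine Measurable.const_mul (Finset.measurable_sum _ fun x _ => ?_) _
  refine Measurable.const_mul (Measurable.sub_const ?_ _) _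
  exact O.measurable.comp ((configShift (-x)).measurable.comp measurable_skewLift)

omit [NeZero N] in
/-- The smeared field is bounded (the observable is). -/
theorem exists_abs_smearedLatticeField_le (O : YMSpecies G) (Λ : Finset (Site 4)) (a cc m : ℝ)
    (h : 𝓢(E4, ℝ)) : ∃ C : ℝ, ∀ V : LGConfig 4 G, |smearedLatticeField O.F Λ a cc m h V| ≤ C := by
  obtain ⟨C₀, hC₀⟩ := O.bounded
  refine ⟨|cc * a ^ 4| * ∑ x ∈ Λ, |h (a • siteToE x)| * (C₀ + |m|), fun V => ?_⟩
  unfold smearedLatticeField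
  rw [abs_mul]
  refine mul_le_mul_of_nonneg_left ((Finset.abs_sum_le_sum_abs _ _).trans (Finset.sum_le_sum fun x _ => ?_))
    (abs_nonneg _)
  rw [abs_mul]
  exact mul_le_mul_of_nonneg_left ((abs_sub _ _).trans (add_le_add (hC₀ _) le_rfl)) (abs_nonneg _)

end CoverSupport

/-! ## §E Test-function bookkeeping: `⁰𝒮` under frames, slabs of appended families, compact supports -/

section TestFunctions

variable {n m : ℕ}

/-- `⁰𝒮` is stable under the diagonal action of a linear isometry (chain rule: the derivatives of `F ∘ L`
at a coincident point are those of `F` at a coincident point, composed with `L`). -/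
theorem isOffDiagonal_linActMulti {F : 𝓢((Fin n → E4), ℂ)} (hF : IsOffDiagonal F) (L : E4 ≃ₗᵢ[ℝ] E4) :
    IsOffDiagonal (linActMulti L F) := by
  intro x hx k
  let g : (Fin n → E4) ≃L[ℝ] (Fin n → E4) :=
    ContinuousLinearEquiv.piCongrRight fun _ : Fin n => L.symm.toContinuousLinearEquiv
  have hfg : ((linActMulti L F : 𝓢((Fin n → E4), ℂ)) : (Fin n → E4) → ℂ) =
      (F : (Fin n → E4) → ℂ) ∘ ((g : (Fin n → E4) →L[ℝ] (Fin n → E4)) : (Fin n → E4) → (Fin n → E4)) := by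
    funext y; rfl
  rw [hfg, (g : (Fin n → E4) →L[ℝ] (Fin n → E4)).iteratedFDeriv_comp_right (F.smooth ⊤) x
    (by exact_mod_cast le_top)]
  have hgx : (g : (Fin n → E4) →L[ℝ] (Fin n → E4)) x ∈ coincidenceLocus n E4 := by
    obtain ⟨i, j, hij, h⟩ := hx
    refine ⟨i, j, hij, ?_⟩
    show L.symm (x i) = L.symm (x j)
    rw [h]
  rw [hF _ hgx k]
  rfl

/-- A tensor product whose factors have pairwise disjoint supports lies in `⁰𝒮`. -/
theorem isOffDiagonal_of_isTensorOf_disjoint {F : 𝓢((Fin n → E4), ℂ)} {φ : Fin n → 𝓢(E4, ℂ)}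
    (hF : IsTensorOf F φ)
    (h : ∀ i j, i ≠ j → Disjoint (tsupport (φ i : E4 → ℂ)) (tsupport (φ j : E4 → ℂ))) :
    IsOffDiagonal F :=
  IsOffDiagonal.of_tsupport_subset fun x hx hxc => by
    obtain ⟨i, j, hij, hxij⟩ := hxc
    have hi := hF.tsupport_subset hx i
    have hj := hF.tsupport_subset hx j
    rw [hxij] at hi
    exact Set.disjoint_left.1 (h i j hij) hi hj

/-- Support of a complexified real test function. -/
theorem tsupport_ofRealTest_subset (f : 𝓢(E4, ℝ)) :
    tsupport (ofRealTest f : E4 → ℂ) ⊆ tsupport (f : E4 → ℝ) :=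
  tsupport_comp_subset (g := fun t : ℝ => (t : ℂ)) Complex.ofReal_zero _

/-- Support of `Θ f = f ∘ θ`. -/
theorem tsupport_thetaTest_subset (f : 𝓢(E4, ℝ)) :
    tsupport (thetaTest 4 f : E4 → ℝ) ⊆ {x | timeReflection 4 x ∈ tsupport (f : E4 → ℝ)} := by
  have : (thetaTest 4 f : E4 → ℝ) = fun y => f (timeReflection 4 y) := funext fun y => thetaTest_apply 4 f y
  rw [this]
  exact tsupport_schwartz_comp_subset f (timeReflection 4).continuous

/-- `f ∘ L⁻¹` has compact support if `f` has. -/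
theorem hasCompactSupport_linActTest {f : 𝓢(E4, ℝ)} (hf : HasCompactSupport (f : E4 → ℝ))
    (L : E4 ≃ₗᵢ[ℝ] E4) : HasCompactSupport (linActTest L f : E4 → ℝ) :=
  hf.comp_homeomorph L.symm.toHomeomorph

/-- `Θ f` has compact support if `f` has. -/
theorem hasCompactSupport_thetaTest {f : 𝓢(E4, ℝ)} (hf : HasCompactSupport (f : E4 → ℝ)) :
    HasCompactSupport (thetaTest 4 f : E4 → ℝ) :=
  hasCompactSupport_linActTest hf _

/-- **Slabs of the appended family.** For real factors `f_I` in positive ordered time slabs and `f_J` likewise,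
the appended family `(θ f_{I, n−1−l})_l ++ (f_{J,l})_l` (the real factors of `Θ P_I* ⊗ P_J`) is supported in
pairwise ordered time slabs (reflected ones negative and reversed, the others positive). -/
theorem append_slabs {fI : Fin n → 𝓢(E4, ℝ)} {loI hiI : Fin n → ℝ} {fJ : Fin m → 𝓢(E4, ℝ)}
    {loJ hiJ : Fin m → ℝ} (hloI : ∀ i, 0 < loI i) (hleI : ∀ i, loI i ≤ hiI i)
    (hordI : ∀ i j, i < j → hiI i < loI j)
    (hsuppI : ∀ i, tsupport (fI i : E4 → ℝ) ⊆ {x | loI i ≤ x 0 ∧ x 0 ≤ hiI i})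
    (hloJ : ∀ j, 0 < loJ j) (hleJ : ∀ j, loJ j ≤ hiJ j) (hordJ : ∀ i j, i < j → hiJ i < loJ j)
    (hsuppJ : ∀ j, tsupport (fJ j : E4 → ℝ) ⊆ {x | loJ j ≤ x 0 ∧ x 0 ≤ hiJ j}) :
    ∃ lo hi : Fin (n + m) → ℝ, (∀ p, lo p ≤ hi p) ∧ (∀ p q, p < q → hi p < lo q) ∧
      ∀ p, tsupport ((Fin.append (fun i => thetaTest 4 (fI (Fin.rev i))) fJ p : 𝓢(E4, ℝ)) : E4 → ℝ) ⊆
        {x | lo p ≤ x 0 ∧ x 0 ≤ hi p} := by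
  refine ⟨Fin.append (fun i => -hiI (Fin.rev i)) loJ, Fin.append (fun i => -loI (Fin.rev i)) hiJ,
    fun p => ?_, fun p q hpq => ?_, fun p => ?_⟩
  · induction p using Fin.addCases with
    | left i => simp only [Fin.append_left]; linarith [hleI (Fin.rev i)]
    | right j => simp only [Fin.append_right]; exact hleJ j
  · induction p using Fin.addCases with
    | left i =>
      induction q using Fin.addCases with
      | left i' =>
        simp only [Fin.append_left]
        have h1 : (Fin.castAdd m i : ℕ) < (Fin.castAdd m i' : ℕ) := hpq
        simp only [Fin.val_castAdd] at h1
        have hii' : i < i' := Fin.lt_def.2 h1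
        have := hordI (Fin.rev i') (Fin.rev i) (Fin.rev_lt_rev.2 hii')
        linarith
      | right j' =>
        simp only [Fin.append_left, Fin.append_right]
        linarith [hloI (Fin.rev i), hloJ j']
    | right j =>
      induction q using Fin.addCases with
      | left i' =>
        exfalso
        have h1 : (Fin.natAdd n j : ℕ) < (Fin.castAdd m i' : ℕ) := hpq
        simp only [Fin.val_natAdd, Fin.val_castAdd] at h1
        omega
      | right j' =>
        simp only [Fin.append_right]
        have h1 : (Fin.natAdd n j : ℕ) < (Fin.natAdd n j' : ℕ) := hpq
        simp only [Fin.val_natAdd] at h1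
        exact hordJ j j' (Fin.lt_def.2 (by omega))
  · induction p using Fin.addCases with
    | left i =>
      simp only [Fin.append_left]
      intro x hx
      have h1 := hsuppI (Fin.rev i) (tsupport_thetaTest_subset _ hx)
      simp only [Set.mem_setOf_eq, timeReflection_apply, if_true] at h1
      constructor <;> linarith [h1.1, h1.2]
    | right j =>
      simp only [Fin.append_right]
      exact hsuppJ j

/-- The real factors of `Θ P_I* ⊗ P_J` are the appended family. -/
theorem isTensorOf_osAdjoint_appendTensor {PI : 𝓢((Fin n → E4), ℂ)} {PJ : 𝓢((Fin m → E4), ℂ)}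
    {fI : Fin n → 𝓢(E4, ℝ)} {fJ : Fin m → 𝓢(E4, ℝ)} (hI : IsTensorOf PI fun i => ofRealTest (fI i))
    (hJ : IsTensorOf PJ fun j => ofRealTest (fJ j)) :
    IsTensorOf ((osAdjoint PI).appendTensor PJ)
      fun p => ofRealTest (Fin.append (fun i => thetaTest 4 (fI (Fin.rev i))) fJ p) := by
  -- adapted from `IsSchwingerFamilyOf.osPairing_tensor` (Literature/QuantumLattice/SchwingerOSPositivity)
  rw [← append_ofRealTest]
  exact hI.osAdjoint.appendTensor hJ

/-- Pairwise ordered slabs are pairwise disjoint supports, so the appended tensor lies in `⁰𝒮`. -/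
theorem isOffDiagonal_of_slabs {k : ℕ} {F : 𝓢((Fin k → E4), ℂ)} {g : Fin k → 𝓢(E4, ℝ)}
    (hF : IsTensorOf F fun p => ofRealTest (g p)) {lo hi : Fin k → ℝ}
    (hord : ∀ p q, p < q → hi p < lo q)
    (hsupp : ∀ p, tsupport (g p : E4 → ℝ) ⊆ {x | lo p ≤ x 0 ∧ x 0 ≤ hi p}) : IsOffDiagonal F := by
  refine isOffDiagonal_of_isTensorOf_disjoint hF fun p q hpq => Set.disjoint_left.2 fun x hxp hxq => ?_
  have hp := hsupp p (tsupport_ofRealTest_subset _ hxp)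
  have hq := hsupp q (tsupport_ofRealTest_subset _ hxq)
  rcases lt_or_gt_of_ne hpq with h | h
  · have := hord p q h; linarith [hp.2, hq.1]
  · have := hord q p h; linarith [hp.1, hq.2]

variable {R : E4 ≃ₗᵢ[ℝ] E4} {c : ℝ}

/-- In the frame, the reflected factor is the swapped factor: `(Θ f) ∘ R⁻¹ = (f ∘ R⁻¹) ∘ swap`. -/
theorem linActTest_thetaTest_apply (hR : R (ee 0) = c • ee 0 + (-c) • ee 1) (hc : c ^ 2 = 1 / 2)
    (f : 𝓢(E4, ℝ)) (v : E4) : linActTest R (thetaTest 4 f) v = linActTest R f (swap01 v) := by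
  rw [linActTest_apply, linActTest_apply, thetaTest_apply, frame_reflection hR hc]

open Literature.Probability.LatticeModels (Site) in
/-- **Where a frame-rotated slab factor charges the lattice.** If `supp f ⊆ {lo ≤ x⁰ ≤ hi}` and the spacing `a`
is small while `a L` is large, a lattice point `x` with `(f ∘ R⁻¹)(a x) ≠ 0` has sheared coordinate
`u = x₀ − x₁` at distance `≥ 2ϱ + 1` from both mirror layers `u = 0` and `u = 2L + 1` of the cover. -/
theorem sheared_range_of_ne_zero (hR : R (ee 0) = c • ee 0 + (-c) • ee 1) (hc0 : 0 < c) {f : 𝓢(E4, ℝ)}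
    {lo hi : ℝ} (hf : tsupport (f : E4 → ℝ) ⊆ {z | lo ≤ z 0 ∧ z 0 ≤ hi}) {a : ℝ} (ha : 0 < a) {ϱ L : ℕ}
    (h1 : a * (c * (2 * ϱ + 1)) < lo) (h2 : hi < c * a * (2 * (L : ℝ) - 2 * ϱ - 1)) (x : Site 4)
    (hne : linActTest R f (a • siteToE x) ≠ 0) :
    (2 * ϱ + 1 : ℤ) ≤ x 0 - x 1 ∧ x 0 - x 1 + 2 * ϱ + 2 ≤ ((2 * L + 1 : ℕ) : ℤ) := by
  rw [linActTest_apply] at hne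
  have hmem := hf (subset_tsupport _ (Function.mem_support.2 hne))
  simp only [Set.mem_setOf_eq, frame_time hR, PiLp.smul_apply, siteToE_apply, smul_eq_mul] at hmem
  set u : ℤ := x 0 - x 1 with hu
  have hca : 0 < c * a := mul_pos hc0 ha
  have hcast : c * (a * ((x 0 : ℤ) : ℝ) - a * ((x 1 : ℤ) : ℝ)) = (c * a) * (u : ℝ) := by
    rw [hu]; push_cast; ring
  rw [hcast] at hmem
  obtain ⟨hlo', hhi'⟩ := hmem
  constructor
  · have h3 : (c * a) * ((2 * ϱ + 1 : ℤ) : ℝ) < (c * a) * (u : ℝ) := by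
      push_cast; nlinarith
    have h4 := Int.cast_lt.1 (lt_of_mul_lt_mul_left h3 hca.le)
    omega
  · have h3 : (c * a) * (u : ℝ) < (c * a) * ((2 * (L : ℤ) - 2 * ϱ - 1 : ℤ) : ℝ) := by
      push_cast; nlinarith
    have h4 := Int.cast_lt.1 (lt_of_mul_lt_mul_left h3 hca.le)
    push_cast; omega

end TestFunctions

/-! ## §G Eventual behaviour of the scheme: `L_k → ∞`, `a_k → 0`, `a_k L_k → ∞` -/

section Scheme

variable {ι : Type} (sch : SpeciesScheme ι)

/-- Eventually `1 ≤ L_k` (`a_k → 0` and `a_k L_k → ∞` force `L_k → ∞`). -/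
theorem eventually_one_le_L : ∀ᶠ k in atTop, 1 ≤ sch.L k := by
  -- adapted from `eventually_le_schemeL` (Cruxes/DiagonalMirrorRPR/Disproof §2)
  have ha : ∀ᶠ k in atTop, sch.a k ≤ 1 :=
    (sch.tendsto_a.eventually (gt_mem_nhds (by norm_num : (0 : ℝ) < 1))).mono fun k hk => hk.le
  have hL : ∀ᶠ k in atTop, ((1 : ℕ) : ℝ) ≤ sch.a k * sch.L k := sch.tendsto_L.eventually (eventually_ge_atTop _)
  filter_upwards [ha, hL] with k hak hLk
  have h1 : sch.a k * sch.L k ≤ sch.L k := by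
    have := mul_le_of_le_one_left (Nat.cast_nonneg (sch.L k)) hak
    simpa using this
  exact_mod_cast hLk.trans h1

/-- Eventually `2 ≤ side_k`. -/
theorem eventually_two_le_side : ∀ᶠ k in atTop, 2 ≤ sch.side k :=
  (eventually_one_le_L sch).mono fun k hk => by unfold SpeciesScheme.side; omega

/-- Eventually `a_k K < lo` for `lo > 0`. -/
theorem eventually_a_mul_lt (K : ℝ) {lo : ℝ} (hlo : 0 < lo) : ∀ᶠ k in atTop, sch.a k * K < lo := by
  have h := sch.tendsto_a.mul_const K
  rw [zero_mul] at h
  exact h.eventually_lt_const hlo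

/-- Eventually `hi < c a_k (2 L_k − 2ϱ − 1)` for `c > 0`. -/
theorem eventually_lt_window {c : ℝ} (hc : 0 < c) (ϱ : ℕ) (hi : ℝ) :
    ∀ᶠ k in atTop, hi < c * sch.a k * (2 * (sch.L k : ℝ) - 2 * ϱ - 1) := by
  have h1 : Tendsto (fun k => 2 * c * (sch.a k * sch.L k)) atTop atTop :=
    sch.tendsto_L.const_mul_atTop (by positivity)
  have h2 : Tendsto (fun k => -(c * sch.a k * (2 * ϱ + 1))) atTop (𝓝 (-(c * 0 * (2 * ϱ + 1)))) :=
    ((sch.tendsto_a.const_mul c).mul_const _).neg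
  have h4 := (h1.atTop_add h2).eventually_gt_atTop hi
  refine h4.mono fun k hk => ?_
  have : 2 * c * (sch.a k * sch.L k) + -(c * sch.a k * (2 * ϱ + 1)) =
      c * sch.a k * (2 * (sch.L k : ℝ) - 2 * ϱ - 1) := by ring
  rwa [this] at hk

end Scheme

section SupportStub

open Literature.Probability.LatticeModels (Site)

/-- **Sub-goal `stub_rpClosure_support` of `stub_rpClosure` (cylinder dependence on the positive half).** If the
test function only charges lattice points whose sheared coordinate `u = x₀ − x₁` keeps the margin `2ϱ + 1` from both
mirror layers (`ϱ` a radius of the observable's edge support), the smeared field on the cover depends only on the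
edges of the closed positive half. -/
theorem stub_rpClosure_support :
    ∀ {G : Type} [Group G] [MeasurableSpace G] {N : ℕ} [NeZero N] (O : YMSpecies G) {ϱ : ℕ},
      (∀ e ∈ O.supp, ∀ i, |e.1 i| ≤ (ϱ : ℤ)) →
      ∀ (Λ : Finset (Site 4)) (a cc m : ℝ) (h : 𝓢(E4, ℝ)),
        (∀ x ∈ Λ, h (a • siteToE x) ≠ 0 → (2 * ϱ + 1 : ℤ) ≤ x 0 - x 1 ∧ x 0 - x 1 + 2 * ϱ + 2 ≤ N) →
          DependsOn (fun U : TConfig (2 * N) N N G => smearedLatticeField O.F Λ a cc m h (skewLift N U))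
            (posEdges N) :=
  fun O _ hϱ Λ a cc m h hsupp => dependsOn_smearedLatticeField O hϱ Λ a cc m h hsupp

end SupportStub

end RpClosure

end Summit.QuantumFields.YangMills.Cruxes.DiagonalMirrorRPR.ParityBridgeColdTraces

end
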